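import Mathlib
import Summits.KontsevichZagierPeriods.Zeta5Search.WedgeDictionaryWideInduction
import Summits.KontsevichZagierPeriods.Zeta5Search.WedgeDictionaryForms
import HarnessLib

/-!
# Consequences of `wedgeDictionaryFull` on the whole wide region (cell `pub-zeta5`, seat ct-1 g23)

HONEST FRAMING: systematic search; no irrationality claim unless certified.  Modus ponens over ct-1 g23's `wedgeDictionaryFull_holds` /
`explicitPQAt_wide`: identities of real numbers among Brown–Zudilin's convergent integrals, their leading coefficient (17) and the
cell's closed forms on the WIDE region `b(a) ≥ 0`, `d ≥ 0`; no bound on any linear form, no `γ`, nothing about `ζ(5)`; no `def`, no node.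

ct-1 g22's `WedgeDictionaryClosingConsequences` recorded these on the HALF BOX (`0 ≤ 2b_i ≤ b₀+1`, admissible partner); here the
hypotheses are only `Converges a`, `b(a)_i ≥ 0`, `d ≥ 0`, any `j ∈ [1,7]`:

* `decomposition_on_wide_region` — the SHAPE of Brown–Zudilin's (4) with leading coefficient (17): `∃ P̂ P ∈ ℚ,
  I(a) = Q(a)(2ζ(5) + 4ζ(3)ζ(2)) − 4P̂ζ(2) − 2P` (the named Literature fact `BrownZudilin2022.decomposition` asserts this on the WHOLE
  convergence cone; the points with some `b_i < 0` remain outside what is proved);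
* `approximatingForm_wide` — `Q(a)ζ(5) − P(a) = ρ(a)·(W(b′)·F̃₇(b) − W(b)·F̃₇(b′))`, `P(a) = ρ(W′V − WV′)`;
* `abs_approximatingForm_le_wide` — the triangle-inequality bound by the two very-well-poised series.
-/

noncomputable section

open Finset

namespace Summit.KontsevichZagierPeriods.Zeta5Search.WedgeDictionaryWideConsequences

open Summit.KontsevichZagierPeriods.Zeta5Search.WedgeDictionary
open Summit.KontsevichZagierPeriods.Zeta5Search.DualSeries
open Summit.KontsevichZagierPeriods.Zeta5Search.WedgeDictionaryWideInduction (explicitPQAt_wide)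
open Summit.KontsevichZagierPeriods.Zeta5Search.WedgeDictionaryFullQ (wedgeDictionaryFull_Q)
open Literature.NumberTheory.Irrationality.BrownZudilin2022 (bOfA Converges QOf cellularIntegral vwpDual)
open Literature.NumberTheory.Transcendental (zetaValue)

/-- **The SHAPE of Brown–Zudilin's (4) with leading coefficient (17) on the WHOLE WIDE REGION**: for every convergent `a` with
`b(a) ≥ 0` and `d(b(a)) ≥ 0`, `∃ P̂ P ∈ ℚ, I(a) = Q(a)(2ζ(5) + 4ζ(3)ζ(2)) − 4P̂ζ(2) − 2P` (witnesses: the dictionary's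
`P̂_d(a)`, `P_d(a)` at partner `1`). [folklore] -/
theorem decomposition_on_wide_region (a : Fin 8 → ℤ) (hconv : Converges a) (hnn : ∀ i ∈ Icc 1 7, 0 ≤ bOfA a i)
    (hd : 0 ≤ dOf (bOfA a)) :
    ∃ Phat P : ℚ, cellularIntegral a =
      (QOf a : ℝ) * (2 * zetaValue 5 + 4 * zetaValue 3 * zetaValue 2) - 4 * (Phat : ℝ) * zetaValue 2 - 2 * (P : ℝ) :=
  ⟨dictPhat a 1, dictP a 1, explicitPQAt_wide (show 1 ∈ Icc 1 7 by simp) hconv hnn hd⟩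

/-- **The approximating form on the whole wide region**: `Q(a)·ζ(5) − P(a) = ρ(a)·(W(b′)·F̃₇(b) − W(b)·F̃₇(b′))` with
`P(a) = ρ(W′V − WV′)`, `b = b(a)`, `b′ = b + e_j`, for every convergent `a` with `b(a) ≥ 0`, `d ≥ 0` and every `j ∈ [1,7]`
(`wedgeDictionaryFull_Q` and the `ζ(3)`-elimination `zeta3_elimination`). [folklore] -/
theorem approximatingForm_wide (a : Fin 8 → ℤ) {j : ℕ} (hj : j ∈ Icc 1 7) (hconv : Converges a)
    (hnn : ∀ i ∈ Icc 1 7, 0 ≤ bOfA a i) (hd : 0 ≤ dOf (bOfA a)) :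
    (QOf a : ℝ) * zetaValue 5 -
        ((rhoOf a * (coeffW (Function.update (bOfA a) j (bOfA a j + 1)) * coeffV (bOfA a) -
            coeffW (bOfA a) * coeffV (Function.update (bOfA a) j (bOfA a j + 1))) : ℚ) : ℝ) =
      (rhoOf a : ℝ) * ((coeffW (Function.update (bOfA a) j (bOfA a j + 1)) : ℝ) * vwpDual 7 (bOfA a) -
        (coeffW (bOfA a) : ℝ) * vwpDual 7 (Function.update (bOfA a) j (bOfA a j + 1))) := by
  have hQ := wedgeDictionaryFull_Q hconv hnn hd hj
  obtain ⟨hbox, hle⟩ := inBox_of_full a hconv hnn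
  have hQ' : ((QOf a : ℤ) : ℝ) = (rhoOf a : ℝ) * ((coeffU (bOfA a) : ℝ) *
      coeffW (Function.update (bOfA a) j (bOfA a j + 1)) -
        coeffU (Function.update (bOfA a) j (bOfA a j + 1)) * coeffW (bOfA a)) := by
    have h := congrArg (fun q : ℚ => (q : ℝ)) hQ
    push_cast at h
    exact h
  have hE := zeta3_elimination (bOfA a) hbox hd hj (hle j hj)
  push_cast at hE ⊢
  rw [hQ', mul_sub (rhoOf a : ℝ) ((coeffW (Function.update (bOfA a) j (bOfA a j + 1)) : ℝ) *
    vwpDual 7 (bOfA a)), ← mul_sub, hE]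
  ring

/-- **The size of the approximating form is controlled by the two very-well-poised series** on the whole wide region:
`|Q(a)ζ(5) − P(a)| ≤ |ρ|·(|W′|·|F̃₇(b)| + |W|·|F̃₇(b′)|)`.  A triangle inequality; no asymptotic claim. [folklore] -/
theorem abs_approximatingForm_le_wide (a : Fin 8 → ℤ) {j : ℕ} (hj : j ∈ Icc 1 7) (hconv : Converges a)
    (hnn : ∀ i ∈ Icc 1 7, 0 ≤ bOfA a i) (hd : 0 ≤ dOf (bOfA a)) :
    |(QOf a : ℝ) * zetaValue 5 -
        ((rhoOf a * (coeffW (Function.update (bOfA a) j (bOfA a j + 1)) * coeffV (bOfA a) -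
            coeffW (bOfA a) * coeffV (Function.update (bOfA a) j (bOfA a j + 1))) : ℚ) : ℝ)| ≤
      |(rhoOf a : ℝ)| * (|(coeffW (Function.update (bOfA a) j (bOfA a j + 1)) : ℝ)| * |vwpDual 7 (bOfA a)| +
        |(coeffW (bOfA a) : ℝ)| * |vwpDual 7 (Function.update (bOfA a) j (bOfA a j + 1))|) := by
  rw [approximatingForm_wide a hj hconv hnn hd, abs_mul]
  refine mul_le_mul_of_nonneg_left ?_ (abs_nonneg _)
  calc |(coeffW (Function.update (bOfA a) j (bOfA a j + 1)) : ℝ) * vwpDual 7 (bOfA a) -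
          (coeffW (bOfA a) : ℝ) * vwpDual 7 (Function.update (bOfA a) j (bOfA a j + 1))|
        ≤ |(coeffW (Function.update (bOfA a) j (bOfA a j + 1)) : ℝ) * vwpDual 7 (bOfA a)| +
          |(coeffW (bOfA a) : ℝ) * vwpDual 7 (Function.update (bOfA a) j (bOfA a j + 1))| := abs_sub _ _
    _ = |(coeffW (Function.update (bOfA a) j (bOfA a j + 1)) : ℝ)| * |vwpDual 7 (bOfA a)| +
          |(coeffW (bOfA a) : ℝ)| * |vwpDual 7 (Function.update (bOfA a) j (bOfA a j + 1))| := by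
        rw [abs_mul, abs_mul]

end Summit.KontsevichZagierPeriods.Zeta5Search.WedgeDictionaryWideConsequences

end
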